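import Literature.NumberTheory.EllipticCurves.SelmerTrivialCorankProofs
import Literature.NumberTheory.EllipticCurves.BSDSelmerPConverseRankZeroProofs
import Literature.NumberTheory.EllipticCurves.LeadingTermBSZOrdinaryProofs
import Literature.NumberTheory.EllipticCurves.OpenImageMazurAssemblyProofs
import Literature.NumberTheory.EllipticCurves.HeightDensityFullBSDOffS
import Literature.NumberTheory.EllipticCurves.LeadingTermBSZRankZeroMultiplicativeLegProofs
import Literature.NumberTheory.EllipticCurves.Skinner2016.SelmerCorankOfVanishingLValue
import Literature.NumberTheory.EllipticCurves.BhargavaSkinnerZhang2014.RankZeroCriterion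
import HarnessLib

/-!
# Bhargava–Skinner–Zhang, Theorem 5 (the rank-`0` criterion `#Sel^(p)(E/ℚ) = 1 ⟹ rank E(ℚ) = 0 ∧
# ord_{s=1} L(E,s) = 0`) in the kernel — the good-ordinary leg below the main conjecture, both legs
# below [Smult] clause (2) — and the binder `h5` of `bsz_rankLeOne_cRank_of_pieces` on `S₀(5) = {5 ∤ A}`

Fourth sibling *proofs* file (theorems only: no definition, no named fact, no instance; D-0014 /
D-0026) of `Literature.NumberTheory.EllipticCurves.LeadingTerm` for the rank part of BSD by naive
height, next to `LeadingTermBSZProofs`, `LeadingTermBSZAssemblyProofs`,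
`LeadingTermBSZResCellAssemblyProofs`. Source:

> M. Bhargava, C. Skinner, W. Zhang, *A majority of elliptic curves over `ℚ` satisfy the Birch and
> Swinnerton-Dyer conjecture*, arXiv:1407.1826v2 (2014), **Theorem 5** (§2.1, p. 5): "Let `p` be
> an odd prime. Let `E` be an elliptic curve over `ℚ` with conductor `N` such that: (a) `E` has
> good ordinary or multiplicative reduction at `p`; (b) `E[p]` is an irreducible
> `Gal(ℚ̄/ℚ)`-module; (c) there is at least one prime `ℓ ≠ p` such that `ℓ ‖ N` and `E[p]` is
> ramified at `ℓ`; (d) the `p`-Selmer group `S_p(E)` of `E` is trivial. Then the rank and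
> analytic rank of `E` are both equal to `0`." — Remark 8 ibid.: a consequence of [SU]
> (Skinner–Urban, the good ordinary case) and [Smult] (Skinner, Pacific J. Math. 283 (2016), the
> multiplicative case), "both … consequences of the Iwasawa–Greenberg main conjecture".

The theorem of record `bsz_rankLeOne_cRank_of_pieces` (`LeadingTermBSZResCellAssemblyProofs`,
the constant `c_rank = 0.66856…`) consumes Theorem 5 at `p = 5` as the ANONYMOUS binder
`h5 : ∀ AB, IsInHeightFamily AB → S₀ AB → W AB → Nat.card ((shortWeierstrass AB).selmerGroup 5) = 1
→ (shortWeierstrass AB).mordellWeilRank = 0 ∧ (shortWeierstrass AB).analyticRank = 0`, with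
`S₀ = S₀(5) = {5 ∤ A}` (Lemma 17, `bsz_lemma17_mem_S0_five_iff`: good ordinary OR multiplicative
reduction at `5`) and `W ⊆ {E[5] irreducible}`. This file PROVES the GOOD-ORDINARY LEG of that
binder, for every `p ≥ 5` and WITHOUT hypothesis (c), below exactly the three named facts under
which the tree already holds the rank-zero `p`-converse in corank currency
(`analyticRank_eq_zero_of_selmerCorank_eq_zero_of_mainConjecture`, `BSDSelmerPConverseRankZeroProofs`:
`hmod = exists_isNewformOf` (modularity), `hMC = burungale_castella_skinner_charIdeal_eq_padicLFunction`
(Burungale–Castella–Skinner, IMRN 2025, Thm. 1.1.2 (a): Mazur's main conjecture, no (ram)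
hypothesis), `hS = Schneider1985_order_charGenerator` (Perrin-Riou–Schneider)):

* (in the sibling `SelmerTrivialCorankProofs`, FACT-FREE: hypothesis (d) in the tree's currencies —
  `#Sel^(p)(E/K) = 1 ⟹ rank 0, E(K)[p] = 0, Ш[p^∞] = 0, corank_{ℤ_p} Sel_{p^∞} = 0` — and its
  transport along a change of Weierstrass equation, needed because the converse is stated on a
  GLOBAL MINIMAL model while `h5` speaks of `E_{A,B} : y² = x³ + Ax + B`;)
* `bsz_thm5_goodOrdinary_of_mainConjecture` — **Theorem 5, good-ordinary leg, (c)-free**: `W/ℚ`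
  globally minimal, `p ≥ 5` good ordinary, `E[p]` irreducible, `#Sel^(p)(E/ℚ) = 1` ⟹
  `rank E(ℚ) = 0 ∧ ord_{s=1} L(E,s) = 0`, below `hmod`, `hMC`, `hS`;
* (NOT here — it is the cell tool
  `Summit.BirchSwinnertonDyer.Rank1Residual.X10.RankZeroOfTrivialPSelmer.rank_zero_and_analyticRank_zero_of_natCard_selmerGroup_eq_one_of_skinnerUrban`,
  `Summits/BirchSwinnertonDyer/Rank1Residual/X10/RankZeroOfTrivialPSelmer.lean`, x10 GEN 28: the
  good-ordinary leg AS PRINTED, `p ≥ 3` WITH (c) = (ram), below modularity and the Skinner–Urban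
  main conjecture fact `skinner_urban_main_conjecture` — Remark 8's "[SU]" leg, the `p = 3` road;)
* `bsz_thm5_goodOrdinary_of_mainConjecture_of_smul_eq` — the same for ANY model `E/ℚ`, the
  reduction hypotheses being read on a global minimal model `W`, `C • W = E`;
* `bsz_h5_goodOrdinary_five_of_mainConjecture` — **the binder `h5` in its own currency on the good
  half of `S₀(5)`**: for `(A, B)` in the height family with `5 ∤ A` and `5 ∤ 4A³ + 27B²` (good
  ordinary at `5`, Lemma 17) and `E_{A,B}[5]` irreducible,
  `#Sel^(5)(E_{A,B}/ℚ) = 1 ⟹ rank = 0 ∧ analytic rank = 0`, below `hmod`, `hMC`, `hS` — the model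
  transport to a global minimal model (`hasGlobalMinimalModel_rat_holds`, Lemma 17's `a_5`
  transport `not_five_dvd_frobeniusTrace_of_not_dvd`, `hasGoodReductionAtPrime_smul_iff`,
  `hasIrreducibleModPGaloisRep_smul_iff`, `analyticRank_smul`) is done inside.

* `bsz_thm5_of_thmC2`, `bsz_thm5_of_thmC2_of_smul_eq`, `bsz_h5_five_of_thmC2_of_smul_eq`,
  `bsz_h5_five_of_thmC2` — **Theorem 5 on BOTH legs of (a) (good ordinary OR multiplicative,
  `p ≥ 3`, under (irr) + (ram)) from [Smult] = Skinner, Pacific J. Math. 283 (2016), Thm. C, SECOND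
  CLAUSE** ("if `L(E,1) = 0` then `Sel_{p^∞}(E)` has `ℤ_p`-corank at least one"), taken as a
  HYPOTHESIS `hC2` in the binder currency of the tree's `Skinner2016.thmC_padicValRat_bsd_rank_zero`
  (the shape in which the cell registry types that clause as a named fact); and the binder `h5` in
  its own currency on ALL of `S₀(5) = {5 ∤ A}` under (irr) + (ram) below `hC2` alone (rank
  fact-free; `L(E,1) ≠ 0` by the contrapositive of `hC2` at corank `0`; `bsz_lemma17_mem_S0_five_iff`
  for (a) at `p = 5`) — once with (ram) read on a given global minimal model, once ENTIRELY in the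
  `(A, B)` currency with (ram) in the form of Remark 7 (`ℓ > 5` multiplicative for `E_{A,B}`,
  `5 ∤ ord_ℓ(4A³ + 27B²)`; tree `padicValInt_minimalDiscriminantInt_smul_shortWeierstrass`).

What is NOT done here: the MULTIPLICATIVE half of `S₀(5)` BELOW THE MAIN CONJECTURE (i.e. with
[Smult] clause (2) itself derived from Skinner 2016 Thm A = tree fact
`Skinner2016.thmA_charIdeal_multiplicative` plus control at a multiplicative prime and the
Mazur–Tate–Teitelbaum / Greenberg–Stevens interpolation) — that is the sibling
`LeadingTermBSZRankZeroMultiplicativeLegProofs` (`bsz_thm5_multiplicative_of_thmA`,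
`bsz_h5_multiplicative_five_of_thmA`: below `hmod`, Thm A and Greenberg's multiplicative
Euler-characteristic facts, registry A31 / A235 / A236); on that half THIS file offers only the
route through `hC2`.
BSD-DENSITY SPRINT (cell `b2b-bsdres`, book `cells/density/CONVERSION-QUEUE.md` §3 item 2):
by-name consumer = the D2 glue `bsz_rankLeOne_cRank_of_facts` (seat `b2b-bsdres-dens-p1`);
companion AS-PRINTED facts = cc-typer-3's `BhargavaSkinnerZhang2014.thm5_rank_zero_of_pSelmer_trivial`
(T-DENS-Q1I FILE 1), whose good-ordinary restriction at `p ≥ 5` the theorem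
`bsz_thm5_goodOrdinary_of_mainConjecture` discharges with (c) dropped, and the Thm C second-clause
fact `Skinner2016.thmC_one_le_selmerCorank_of_L_one_eq_zero` (T-DENS-Q1I FILE 2, p369278,
`Skinner2016/SelmerCorankOfVanishingLValue.lean`), which instantiates `hC2` verbatim and then
yields FILE 1's statement in full (`bsz_thm5_of_thmC2`); neither def is imported here, so that this
file stays theorems-below-hypotheses and the one-line instantiations are the consumer's. HONEST FRAMING: kernel glue below NAMED published inputs; nothing is
booked; no density number, RESIDUAL-MAP mark, tier or status word moves by this file.

## References

* [BhargavaSkinnerZhang2014] M. Bhargava, C. Skinner, W. Zhang, arXiv:1407.1826v2, Thm. 5 and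
  Rem. 8 (§2.1, p. 5); Lemma 17 (p. 8).
* [SilvermanAEC2009] J. H. Silverman, *The Arithmetic of Elliptic Curves*, 2nd ed., GTM 106
  (2009), Thm. X.4.2; X.§4 (`Ш` and `Sel` are attached to `E/K`, not to an equation); VIII.8
  Cor. 8.3 (global minimal models over `ℚ`).
* [GreenbergLNM1716] R. Greenberg, LNM 1716 (1999), §1 pp. 54, 65–66; Thm. 4.1.
* [BurungaleCastellaSkinner2025] A. Burungale, F. Castella, C. Skinner, IMRN 2025 =
  arXiv:2405.00270, Thm. 1.1.2 (a), proof of Cor. 1.3.1.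
* [Skinner2016PacificMC] C. Skinner, *Multiplicative reduction and the cyclotomic main conjecture
  for* `GL₂`, Pacific J. Math. 283 (2016), 171–200, Thm. C (p. 173), second clause.
-/

noncomputable section

open scoped Classical
open scoped AddSubgroup

open WeierstrassCurve Literature.NumberTheory.EllipticCurves.ModularForms
  Literature.NumberTheory.EllipticCurves.BSZLemma17

namespace Literature.NumberTheory.EllipticCurves

/-- `#Sel^(p)(E/ℚ) = 1 ⟹ corank_{ℤ_p} Sel_{p^∞}(E/ℚ) = 0`, restated locally from the sibling file's
`natCard_selmerGroupPInfty_eq_one_of_natCard_selmerGroup_eq_one` (so that this file does not depend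
on the NAME of the sibling's corank lemma, which is shared with `SelmerCardinalityPConverses.lean`'s
Cassels–Tate version — two files landed in one gate batch). [cite: SilvermanAEC2009, Thm X.4.2] -/
private theorem corank_eq_zero_of_card_selmer_eq_one (W : WeierstrassCurve ℚ) [W.IsElliptic]
    (p : ℕ) [Fact p.Prime] (h : Nat.card (W.selmerGroup p) = 1) : W.selmerCorank p = 0 := by
  have h1 := natCard_selmerGroupPInfty_eq_one_of_natCard_selmerGroup_eq_one W p h
  haveI : Finite (W.selmerGroupPInfty p) := Nat.finite_of_card_ne_zero (by omega)
  exact (finite_selmerGroupPInfty_iff_selmerCorank_eq_zero W p).1 ‹_›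

/-! ### Theorem 5, good-ordinary leg, below the main conjecture (BCS route, no (ram)) -/

section GoodOrdinary

/-- **Bhargava–Skinner–Zhang Thm 5, GOOD-ORDINARY LEG at `p ≥ 5`, hypothesis (c) dropped.** Let
`E/ℚ` have globally minimal model `W`, `p ≥ 5` a prime of good ordinary reduction (`hgood`,
`hord : p ∤ a_p`) with `E[p]` irreducible (`hirr`, printed (b)), and suppose `#Sel^(p)(E/ℚ) = 1`
(printed (d)). Then `rank E(ℚ) = 0` and `ord_{s=1} L(E,s) = 0` — granted modularity (`hmod`),
Mazur's main conjecture in the Burungale–Castella–Skinner form (`hMC`, IMRN 2025 Thm. 1.1.2 (a),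
which needs no ramified prime `ℓ ‖ N`) and Perrin-Riou–Schneider (`hS`). The rank is `0`
fact-free (descent); `Sel_{p^∞}` has corank `0`
(sibling `SelmerTrivialCorankProofs`, fact-free), so the tree's rank-zero `p`-converse
`analyticRank_eq_zero_of_selmerCorank_eq_zero_of_mainConjecture` (Greenberg LNM 1716 §1, Thm. 4.1)
gives analytic rank `0`. Printed source of the deduction: Rem. 8 ("[SU] … consequences of the
Iwasawa–Greenberg main conjecture"). The same statement with an extra Cassels–Tate hypothesis `hCT` is the
cell lead's `rank_zero_of_natCard_selmerGroup_eq_one_of_mainConjecture`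
(`SelmerCardinalityPConverses.lean`, same gate batch); this version is free of `hCT` because the
descent count alone gives corank `0` (sibling `SelmerTrivialCorankProofs`). [cite: BhargavaSkinnerZhang2014, Thm. 5 and Rem. 8 (§2.1, p. 5)]
[cite: GreenbergLNM1716, §1 pp. 65–66 and Thm. 4.1] [cite: BurungaleCastellaSkinner2025, Thm. 1.1.2 (a)] -/
theorem bsz_thm5_goodOrdinary_of_mainConjecture
    (hmod : exists_isNewformOf)
    (hMC : burungale_castella_skinner_charIdeal_eq_padicLFunction)
    (hS : Schneider1985_order_charGenerator)
    (W : WeierstrassCurve ℚ) [W.IsElliptic] [W.IsGloballyMinimal] (p : ℕ) [Fact p.Prime]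
    (hp : 5 ≤ p) (hgood : W.HasGoodReductionAtPrime p) (hord : ¬ (p : ℤ) ∣ W.frobeniusTrace p)
    (hirr : W.HasIrreducibleModPGaloisRep p) (hSel : Nat.card (W.selmerGroup p) = 1) :
    W.mordellWeilRank = 0 ∧ W.analyticRank = 0 :=
  ⟨(rank_eq_zero_and_torsionBy_eq_bot_and_sha_inf_torsionBy_eq_bot_of_natCard_selmerGroup_eq_one
      W p hSel).1,
    analyticRank_eq_zero_of_selmerCorank_eq_zero_of_mainConjecture hmod hMC hS W p hp hgood hord hirr
      (corank_eq_zero_of_card_selmer_eq_one W p hSel)⟩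

/-- **Thm 5, good-ordinary leg, for an ARBITRARY model.** Let `E/ℚ` be an elliptic curve (any
Weierstrass equation) and `W` a global minimal model of it, `C • W = E`; suppose `p ≥ 5`, `W` has
good ordinary reduction at `p`, `E[p]` is irreducible and `#Sel^(p)(E/ℚ) = 1` (both read on `E`:
they are isomorphism invariants). Then `rank E(ℚ) = 0 ∧ ord_{s=1} L(E,s) = 0`, below `hmod`, `hMC`,
`hS` (transport: `hasIrreducibleModPGaloisRep_smul_iff`, `selmerCorank_smul_eq_zero_of_natCard_selmerGroup_eq_one`
with `C⁻¹`, `analyticRank_smul`). [cite: BhargavaSkinnerZhang2014, Thm. 5 (§2.1, p. 5)]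
[cite: SilvermanAEC2009, X.§4 and VIII.8 Cor. 8.3] -/
theorem bsz_thm5_goodOrdinary_of_mainConjecture_of_smul_eq
    (hmod : exists_isNewformOf)
    (hMC : burungale_castella_skinner_charIdeal_eq_padicLFunction)
    (hS : Schneider1985_order_charGenerator)
    {W : WeierstrassCurve ℚ} [W.IsElliptic] [W.IsGloballyMinimal] {C : VariableChange ℚ}
    {E : WeierstrassCurve ℚ} [E.IsElliptic] (hCW : C • W = E) (p : ℕ) [Fact p.Prime]
    (hp : 5 ≤ p) (hgood : W.HasGoodReductionAtPrime p) (hord : ¬ (p : ℤ) ∣ W.frobeniusTrace p)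
    (hirr : E.HasIrreducibleModPGaloisRep p) (hSel : Nat.card (E.selmerGroup p) = 1) :
    E.mordellWeilRank = 0 ∧ E.analyticRank = 0 := by
  refine ⟨(rank_eq_zero_and_torsionBy_eq_bot_and_sha_inf_torsionBy_eq_bot_of_natCard_selmerGroup_eq_one
      E p hSel).1, ?_⟩
  have hWE : C⁻¹ • E = W := by rw [← hCW, smul_smul, inv_mul_cancel, one_smul]
  have hirrW : W.HasIrreducibleModPGaloisRep p := by
    rw [← hWE]; exact (Mazur1978.hasIrreducibleModPGaloisRep_smul_iff E C⁻¹ p).2 hirr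
  have hcorank : W.selmerCorank p = 0 := by
    rw [← hWE]; exact selmerCorank_smul_eq_zero_of_natCard_selmerGroup_eq_one E C⁻¹ p hSel
  have h0 := analyticRank_eq_zero_of_selmerCorank_eq_zero_of_mainConjecture hmod hMC hS W p hp hgood
    hord hirrW hcorank
  rwa [← hWE, analyticRank_smul] at h0

/-- **The binder `h5` of `bsz_rankLeOne_cRank_of_pieces` on the GOOD half of `S₀(5) = {5 ∤ A}`,
below `hmod`, `hMC`, `hS`.** For `(A, B)` in the height family with `5 ∤ A` and `5 ∤ 4A³ + 27B²`
— i.e. `E_{A,B}` has good ORDINARY reduction at `5` (Lemma 17 of the source: good at `5` iff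
`5 ∤ 4A³ + 27B²`, and then `5 ∣ a_5 ↔ 5 ∣ A`; tree `bsz_lemma17_mem_S0_five_iff`,
`not_five_dvd_frobeniusTrace_of_not_dvd`) — and `E_{A,B}[5]` irreducible:
`#Sel^(5)(E_{A,B}/ℚ) = 1 ⟹ rank E_{A,B}(ℚ) = 0 ∧ ord_{s=1} L(E_{A,B}, s) = 0`. The short model
`y² = x³ + Ax + B` need not be minimal at `2, 3`: a global minimal model is taken
(`hasGlobalMinimalModel_rat_holds`, Silverman VIII.8 Cor. 8.3) and everything is transported
(`bsz_thm5_goodOrdinary_of_mainConjecture_of_smul_eq`). The MULTIPLICATIVE half of `S₀(5)`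
(`5 ∣ 4A³ + 27B²`, `5 ∤ A`) is NOT covered here ([Smult]; sibling
`bsz_h5_multiplicative_five_of_thmA`). [cite: BhargavaSkinnerZhang2014, Thm. 5 (§2.1, p. 5) and Lemma 17 (p. 8)]
[cite: BurungaleCastellaSkinner2025, Thm. 1.1.2 (a)] -/
theorem bsz_h5_goodOrdinary_five_of_mainConjecture
    (hmod : exists_isNewformOf)
    (hMC : burungale_castella_skinner_charIdeal_eq_padicLFunction)
    (hS : Schneider1985_order_charGenerator)
    {AB : ℤ × ℤ} (hfam : IsInHeightFamily AB) (hA : ¬ (5 : ℤ) ∣ AB.1)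
    (hD : ¬ (5 : ℤ) ∣ 4 * AB.1 ^ 3 + 27 * AB.2 ^ 2)
    (hirr : (shortWeierstrass AB).HasIrreducibleModPGaloisRep 5)
    (hSel : Nat.card ((shortWeierstrass AB).selmerGroup 5) = 1) :
    (shortWeierstrass AB).mordellWeilRank = 0 ∧ (shortWeierstrass AB).analyticRank = 0 := by
  haveI := isElliptic_shortWeierstrass hfam
  haveI : Fact (Nat.Prime 5) := ⟨Nat.prime_five⟩
  obtain ⟨C, hC⟩ := hasGlobalMinimalModel_rat_holds (shortWeierstrass AB)
  have hCW : C⁻¹ • (C • shortWeierstrass AB) = shortWeierstrass AB := by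
    rw [smul_smul, inv_mul_cancel, one_smul]
  have hgood : (C • shortWeierstrass AB).HasGoodReductionAtPrime 5 :=
    (hasGoodReductionAtPrime_smul_iff (shortWeierstrass AB) C 5).2
      ((hasGoodReductionAtPrime_shortWeierstrass_iff_of_isInHeightFamily 5 hfam le_rfl).2
        (by exact_mod_cast hD))
  have hord : ¬ (5 : ℤ) ∣ (C • shortWeierstrass AB).frobeniusTrace 5 :=
    not_five_dvd_frobeniusTrace_of_not_dvd hCW hA hD
  exact bsz_thm5_goodOrdinary_of_mainConjecture_of_smul_eq hmod hMC hS hCW 5 le_rfl hgood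
    (by exact_mod_cast hord) hirr (by exact_mod_cast hSel)

end GoodOrdinary

/-! ### Theorem 5 on BOTH legs from [Smult] clause (2) (Skinner 2016, Thm C, second clause) -/

section OfThmC

/-- **Bhargava–Skinner–Zhang Thm 5 (both legs: good ordinary OR multiplicative `p ≥ 3`, under
(b) = (irr) and (c) = (ram)) FROM Skinner 2016 Thm C, clause (2).** Remark 8 of the source: Thm 5
"is … a consequence of … [SU] and [Smult]"; the relevant printed sentence of [Smult] = C. Skinner,
Pacific J. Math. 283 (2016), Thm. C (p. 173) is its second clause, "… and if `L(E,1) = 0` then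
`Sel_{p^∞}(E)` has `ℤ_p`-corank at least one", taken here as the HYPOTHESIS `hC2` in exactly the
binder currency of the tree's transcription of its first clause
(`Skinner2016.thmC_padicValRat_bsd_rank_zero`: `3 ≤ p`, (a) good ordinary or multiplicative, (irr),
(ram) in Tate form) — the shape in which the cell registry types it as a named fact (BSD-DENSITY
sprint item `T-DENS-Q1I` FILE 2); nothing about it is asserted here. Deduction: `#Sel^(p)(E/ℚ) = 1`
gives rank `0` fact-free and `corank_{ℤ_p} Sel_{p^∞}(E/ℚ) = 0`
(sibling `SelmerTrivialCorankProofs`, fact-free), so by `hC2` `L(E,1) ≠ 0`, whence analytic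
rank `0` (`analyticRank_eq_zero_of_entireLFunction_one_ne_zero`). [cite: BhargavaSkinnerZhang2014, Thm. 5 and Rem. 8 (§2.1, p. 5)]
[cite: Skinner2016PacificMC, Thm. C (§1, PJM p. 173 = arXiv p. 3 L102–L115), second clause] -/
theorem bsz_thm5_of_thmC2
    (hC2 : ∀ (W : WeierstrassCurve ℚ) [W.IsElliptic] [W.IsGloballyMinimal] (p : ℕ) [Fact p.Prime]
      (_hp : 3 ≤ p)
      (_hred : (W.HasGoodReductionAtPrime p ∧ ¬ (p : ℤ) ∣ W.frobeniusTrace p) ∨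
        W.HasMultiplicativeReductionAtPrime p)
      (_hirr : W.HasIrreducibleModPGaloisRep p)
      (_hram : ∃ ℓ : ℕ, ∃ _ : Fact ℓ.Prime, ℓ ≠ p ∧ W.HasMultiplicativeReductionAtPrime ℓ ∧
        ¬ p ∣ padicValInt ℓ W.minimalDiscriminantInt)
      (_hL : W.entireLFunction 1 = 0), 1 ≤ W.selmerCorank p)
    (W : WeierstrassCurve ℚ) [W.IsElliptic] [W.IsGloballyMinimal] (p : ℕ) [Fact p.Prime]
    (hp : 3 ≤ p)
    (hred : (W.HasGoodReductionAtPrime p ∧ ¬ (p : ℤ) ∣ W.frobeniusTrace p) ∨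
      W.HasMultiplicativeReductionAtPrime p)
    (hirr : W.HasIrreducibleModPGaloisRep p)
    (hram : ∃ ℓ : ℕ, ∃ _ : Fact ℓ.Prime, ℓ ≠ p ∧ W.HasMultiplicativeReductionAtPrime ℓ ∧
      ¬ p ∣ padicValInt ℓ W.minimalDiscriminantInt)
    (hSel : Nat.card (W.selmerGroup p) = 1) :
    W.mordellWeilRank = 0 ∧ W.analyticRank = 0 := by
  refine ⟨(rank_eq_zero_and_torsionBy_eq_bot_and_sha_inf_torsionBy_eq_bot_of_natCard_selmerGroup_eq_one
      W p hSel).1, analyticRank_eq_zero_of_entireLFunction_one_ne_zero W fun hL ↦ ?_⟩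
  have h1 := hC2 W p hp hred hirr hram hL
  have h0 := corank_eq_zero_of_card_selmer_eq_one W p hSel
  omega

/-- **Thm 5 from [Smult] clause (2), for an ARBITRARY model** `E` with global minimal model `W`,
`C • W = E`: the reduction hypotheses (a) and (ram) are read on `W` (they mention `a_p` and
`Δ_min`), (irr) and `#Sel^(p) = 1` on `E`; conclusion for `E`. Transport as in
`bsz_thm5_goodOrdinary_of_mainConjecture_of_smul_eq`. [cite: BhargavaSkinnerZhang2014, Thm. 5 (§2.1, p. 5)]
[cite: SilvermanAEC2009, X.§4 and VIII.8 Cor. 8.3] -/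
theorem bsz_thm5_of_thmC2_of_smul_eq
    (hC2 : ∀ (W : WeierstrassCurve ℚ) [W.IsElliptic] [W.IsGloballyMinimal] (p : ℕ) [Fact p.Prime]
      (_hp : 3 ≤ p)
      (_hred : (W.HasGoodReductionAtPrime p ∧ ¬ (p : ℤ) ∣ W.frobeniusTrace p) ∨
        W.HasMultiplicativeReductionAtPrime p)
      (_hirr : W.HasIrreducibleModPGaloisRep p)
      (_hram : ∃ ℓ : ℕ, ∃ _ : Fact ℓ.Prime, ℓ ≠ p ∧ W.HasMultiplicativeReductionAtPrime ℓ ∧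
        ¬ p ∣ padicValInt ℓ W.minimalDiscriminantInt)
      (_hL : W.entireLFunction 1 = 0), 1 ≤ W.selmerCorank p)
    {W : WeierstrassCurve ℚ} [W.IsElliptic] [W.IsGloballyMinimal] {C : VariableChange ℚ}
    {E : WeierstrassCurve ℚ} [E.IsElliptic] (hCW : C • W = E) (p : ℕ) [Fact p.Prime]
    (hp : 3 ≤ p)
    (hred : (W.HasGoodReductionAtPrime p ∧ ¬ (p : ℤ) ∣ W.frobeniusTrace p) ∨
      W.HasMultiplicativeReductionAtPrime p)
    (hirr : E.HasIrreducibleModPGaloisRep p)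
    (hram : ∃ ℓ : ℕ, ∃ _ : Fact ℓ.Prime, ℓ ≠ p ∧ W.HasMultiplicativeReductionAtPrime ℓ ∧
      ¬ p ∣ padicValInt ℓ W.minimalDiscriminantInt)
    (hSel : Nat.card (E.selmerGroup p) = 1) :
    E.mordellWeilRank = 0 ∧ E.analyticRank = 0 := by
  refine ⟨(rank_eq_zero_and_torsionBy_eq_bot_and_sha_inf_torsionBy_eq_bot_of_natCard_selmerGroup_eq_one
      E p hSel).1, ?_⟩
  have hWE : C⁻¹ • E = W := by rw [← hCW, smul_smul, inv_mul_cancel, one_smul]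
  have hirrW : W.HasIrreducibleModPGaloisRep p := by
    rw [← hWE]; exact (Mazur1978.hasIrreducibleModPGaloisRep_smul_iff E C⁻¹ p).2 hirr
  have hcorank : W.selmerCorank p = 0 := by
    rw [← hWE]; exact selmerCorank_smul_eq_zero_of_natCard_selmerGroup_eq_one E C⁻¹ p hSel
  have hLW : W.entireLFunction 1 ≠ 0 := by
    intro hL
    have h1 := hC2 W p hp hred hirrW hram hL
    omega
  have h0 := analyticRank_eq_zero_of_entireLFunction_one_ne_zero W hLW
  rwa [← hWE, analyticRank_smul] at h0

/-- **The binder `h5` of `bsz_rankLeOne_cRank_of_pieces` on ALL of `S₀(5) = {5 ∤ A}` under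
(irr) + (ram), from [Smult] clause (2)** (`hC2`, the Skinner 2016 Thm C second-clause shape,
instantiated at `p = 5`), (ram) read on a given global minimal model. For `(A, B)` in the height
family and a global minimal model `W` of `E_{A,B}` (`C • W = E_{A,B}`): if `5 ∤ A` — i.e.
`E_{A,B} ∈ S₀(5)`, good ordinary or multiplicative at `5` (Lemma 17, tree
`bsz_lemma17_mem_S0_five_iff`) —, `E_{A,B}[5]` is irreducible, some prime
`ℓ ≠ 5` of multiplicative reduction has `5 ∤ v_ℓ(Δ_min)` (printed (c)), and `#Sel^(5)(E_{A,B}/ℚ) = 1`,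
then `rank E_{A,B}(ℚ) = 0 ∧ ord_{s=1} L(E_{A,B}, s) = 0`.
[cite: BhargavaSkinnerZhang2014, Thm. 5 (§2.1, p. 5) and Lemma 17 (p. 8)]
[cite: Skinner2016PacificMC, Thm. C (§1, PJM p. 173 = arXiv p. 3 L102–L115), second clause] -/
theorem bsz_h5_five_of_thmC2_of_smul_eq
    (hC2 : ∀ (W : WeierstrassCurve ℚ) [W.IsElliptic] [W.IsGloballyMinimal] (p : ℕ) [Fact p.Prime]
      (_hp : 3 ≤ p)
      (_hred : (W.HasGoodReductionAtPrime p ∧ ¬ (p : ℤ) ∣ W.frobeniusTrace p) ∨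
        W.HasMultiplicativeReductionAtPrime p)
      (_hirr : W.HasIrreducibleModPGaloisRep p)
      (_hram : ∃ ℓ : ℕ, ∃ _ : Fact ℓ.Prime, ℓ ≠ p ∧ W.HasMultiplicativeReductionAtPrime ℓ ∧
        ¬ p ∣ padicValInt ℓ W.minimalDiscriminantInt)
      (_hL : W.entireLFunction 1 = 0), 1 ≤ W.selmerCorank p)
    {W : WeierstrassCurve ℚ} [W.IsElliptic] [W.IsGloballyMinimal] {C : VariableChange ℚ}
    {AB : ℤ × ℤ} (hfam : IsInHeightFamily AB) (hCW : C • W = shortWeierstrass AB)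
    (hA : ¬ (5 : ℤ) ∣ AB.1) (hirr : (shortWeierstrass AB).HasIrreducibleModPGaloisRep 5)
    (hram : ∃ ℓ : ℕ, ∃ _ : Fact ℓ.Prime, ℓ ≠ 5 ∧ W.HasMultiplicativeReductionAtPrime ℓ ∧
      ¬ 5 ∣ padicValInt ℓ W.minimalDiscriminantInt)
    (hSel : Nat.card ((shortWeierstrass AB).selmerGroup 5) = 1) :
    (shortWeierstrass AB).mordellWeilRank = 0 ∧ (shortWeierstrass AB).analyticRank = 0 := by
  haveI := isElliptic_shortWeierstrass hfam
  haveI : Fact (Nat.Prime 5) := ⟨Nat.prime_five⟩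
  have hred := (bsz_lemma17_mem_S0_five_iff hfam hCW).2 hA
  exact bsz_thm5_of_thmC2_of_smul_eq hC2 hCW 5 (by norm_num) (by exact_mod_cast hred) hirr
    (by exact_mod_cast hram) (by exact_mod_cast hSel)

/-- **The binder `h5` of `bsz_rankLeOne_cRank_of_pieces` on ALL of `S₀(5) = {5 ∤ A}`, ENTIRELY IN
THE `(A, B)` CURRENCY of the height family, from [Smult] clause (2)** (`hC2`). Hypotheses on
`(A, B) ∈` the family: `5 ∤ A` (= `S₀(5)`, Lemma 17); `E_{A,B}[5]` irreducible (printed (b));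
printed (c) in the form of Remark 7 of the source — "for `ℓ ≥ 5`, a Weierstrass equation `E_{A,B}`
… is minimal at `ℓ`, and so if `ℓ ‖ N` then `E_{A,B}[p]` is ramified at `ℓ` if and only if
`p ∤ ord_ℓ(Δ(E_{A,B}))`": some prime `ℓ > 5` of multiplicative reduction of `E_{A,B}` (for `ℓ ≥ 5`
this is `ℓ ∣ 4A³ + 27B² ∧ ℓ ∤ A`, tree `hasMultiplicativeReductionAtPrime_shortWeierstrass_iff_of_isInHeightFamily`)
with `5 ∤ ord_ℓ(4A³ + 27B²)` (tree `padicValInt_minimalDiscriminantInt_smul_shortWeierstrass`: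
`v_ℓ(Δ_min) = ord_ℓ(4A³ + 27B²)` for `ℓ ≥ 5`); and `#Sel^(5)(E_{A,B}/ℚ) = 1` (printed (d)).
Conclusion: `rank E_{A,B}(ℚ) = 0 ∧ ord_{s=1} L(E_{A,B}, s) = 0`. A global minimal model is taken
inside (`hasGlobalMinimalModel_rat_holds`). (Primes `ℓ ∈ {2, 3}` in (c) are not covered by this
form; use `bsz_h5_five_of_thmC2_of_smul_eq`.)
[cite: BhargavaSkinnerZhang2014, Thm. 5, Rem. 7 (§2.1, p. 5) and Lemma 17 (p. 8)]
[cite: Skinner2016PacificMC, Thm. C (§1, PJM p. 173 = arXiv p. 3 L102–L115), second clause] -/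
theorem bsz_h5_five_of_thmC2
    (hC2 : ∀ (W : WeierstrassCurve ℚ) [W.IsElliptic] [W.IsGloballyMinimal] (p : ℕ) [Fact p.Prime]
      (_hp : 3 ≤ p)
      (_hred : (W.HasGoodReductionAtPrime p ∧ ¬ (p : ℤ) ∣ W.frobeniusTrace p) ∨
        W.HasMultiplicativeReductionAtPrime p)
      (_hirr : W.HasIrreducibleModPGaloisRep p)
      (_hram : ∃ ℓ : ℕ, ∃ _ : Fact ℓ.Prime, ℓ ≠ p ∧ W.HasMultiplicativeReductionAtPrime ℓ ∧
        ¬ p ∣ padicValInt ℓ W.minimalDiscriminantInt)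
      (_hL : W.entireLFunction 1 = 0), 1 ≤ W.selmerCorank p)
    {AB : ℤ × ℤ} (hfam : IsInHeightFamily AB) (hA : ¬ (5 : ℤ) ∣ AB.1)
    (hirr : (shortWeierstrass AB).HasIrreducibleModPGaloisRep 5)
    (hram : ∃ ℓ : ℕ, ∃ _ : Fact ℓ.Prime, 5 < ℓ ∧
      (shortWeierstrass AB).HasMultiplicativeReductionAtPrime ℓ ∧
      ¬ 5 ∣ padicValInt ℓ (4 * AB.1 ^ 3 + 27 * AB.2 ^ 2))
    (hSel : Nat.card ((shortWeierstrass AB).selmerGroup 5) = 1) :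
    (shortWeierstrass AB).mordellWeilRank = 0 ∧ (shortWeierstrass AB).analyticRank = 0 := by
  haveI := isElliptic_shortWeierstrass hfam
  obtain ⟨C, hC⟩ := hasGlobalMinimalModel_rat_holds (shortWeierstrass AB)
  have hCW : C⁻¹ • (C • shortWeierstrass AB) = shortWeierstrass AB := by
    rw [smul_smul, inv_mul_cancel, one_smul]
  obtain ⟨ℓ, hℓ, h5ℓ, hmult, hval⟩ := hram
  have hramW : ∃ ℓ : ℕ, ∃ _ : Fact ℓ.Prime, ℓ ≠ 5 ∧
      (C • shortWeierstrass AB).HasMultiplicativeReductionAtPrime ℓ ∧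
      ¬ 5 ∣ padicValInt ℓ (C • shortWeierstrass AB).minimalDiscriminantInt := by
    refine ⟨ℓ, hℓ, by omega, (hasMultiplicativeReductionAtPrime_smul_iff _ C ℓ).2 hmult, ?_⟩
    rwa [padicValInt_minimalDiscriminantInt_smul_shortWeierstrass hfam (C • shortWeierstrass AB) C
      rfl (by omega)]
  exact bsz_h5_five_of_thmC2_of_smul_eq hC2 hfam hCW hA hirr hramW hSel

end OfThmC

/-!
# Part 2 — Bhargava–Skinner–Zhang, Theorem 5 on BOTH legs of hypothesis (a), and the binder `h5` of
# `bsz_rankLeOne_cRank_of_pieces` on ALL of `S₀(5) = {5 ∤ A}` — the two-leg combinators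

PLACEMENT NOTE (Part 2). This part was drafted and farm-checked as a separate sibling module
`LeadingTermBSZRankZeroLegProofs`-importing file `LeadingTermBSZRankZeroH5Proofs.lean` (cell
`b2b-bsdres`, seat `b2b-bsdres-additive-p1`, 2026-08-24, sha16 740e190c510a5b8b of that draft); it is
landed here, APPENDED to Part 1 with every Part-1 declaration byte-identical, because under the
2026-08-24/25 build-lane outage a new module importing this one could not be elaborated until this
module's olean existed, whereas an append is elaborated from source over built imports (cell-lead
advisory, cell INBOX l.17765). Fully qualified names are unchanged by the placement; only the module
path differs from the announced one. The text below is the module docstring of that draft.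

Eighth sibling *proofs* file (theorems only: no definition, no named fact, no instance; D-0014 /
D-0026) of `Literature.NumberTheory.EllipticCurves.LeadingTerm` for the rank part of BSD by naive
height. It only COMBINES the two legs already in the tree:

* the GOOD-ORDINARY leg (`LeadingTermBSZRankZeroLegProofs`: `bsz_thm5_goodOrdinary_of_mainConjecture`,
  `…_of_smul_eq`, `bsz_h5_goodOrdinary_five_of_mainConjecture` — `p ≥ 5`, hypothesis (c) = (ram)
  NOT needed, below `hmod = exists_isNewformOf`, `hMC = burungale_castella_skinner_charIdeal_eq_padicLFunction`
  (Burungale–Castella–Skinner, IMRN 2025, Thm. 1.1.2 (a)), `hS = Schneider1985_order_charGenerator`);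
* the MULTIPLICATIVE leg (`LeadingTermBSZRankZeroMultiplicativeLegProofs`:
  `bsz_thm5_multiplicative_of_thmA`, `…_of_smul_eq`, `bsz_h5_multiplicative_five_of_thmA`,
  `…_of_smul_eq` — `p ≥ 3`, below `hmod' = nonempty_modularParametrizationData`,
  `hA = Skinner2016.thmA_charIdeal_multiplicative` (Skinner, Pacific J. Math. 283 (2016), Thm. A),
  `hGs` / `hGn = Greenberg1999.thm41Analogue_charValue_rankZero_{split_baseChange,numberField}_anyPrime`
  (Greenberg, LNM 1716, §4 pp. 112–113) and Greenberg–Stevens `greenberg_stevens` at `(E, p)`),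

into the statement of

> M. Bhargava, C. Skinner, W. Zhang, *A majority of elliptic curves over `ℚ` satisfy the Birch and
> Swinnerton-Dyer conjecture*, arXiv:1407.1826v2 (2014), **Theorem 5** (§2.1, p. 5): "Let `p` be
> an odd prime. Let `E` be an elliptic curve over `ℚ` with conductor `N` such that: (a) `E` has
> good ordinary or multiplicative reduction at `p`; (b) `E[p]` is an irreducible
> `Gal(ℚ̄/ℚ)`-module; (c) there is at least one prime `ℓ ≠ p` such that `ℓ ‖ N` and `E[p]` is
> ramified at `ℓ`; (d) the `p`-Selmer group `S_p(E)` of `E` is trivial. Then the rank and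
> analytic rank of `E` are both equal to `0`."

with (a) as the printed DISJUNCTION, at `p ≥ 5` (the good-ordinary leg below BCS needs `p ≥ 5`;
(c) is used on the multiplicative leg only), and into the ANONYMOUS binder
`h5 : ∀ AB, IsInHeightFamily AB → S₀ AB → W AB → Nat.card ((shortWeierstrass AB).selmerGroup 5) = 1
→ rank = 0 ∧ analytic rank = 0` of the theorem of record `bsz_rankLeOne_cRank_of_pieces`
(`LeadingTermBSZResCellAssemblyProofs`) on ALL of `S₀(5) = {5 ∤ A}` (Lemma 17: good ordinary OR
multiplicative at `5`; tree `bsz_lemma17_mem_S0_five_iff`), `W ⊆ {E[5] irreducible} ∩ (ram)`: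

* `bsz_thm5_of_mainConjectures` (+ `_of_smul_eq`) — Thm 5, both legs, `p ≥ 5`, below the SEVEN
  named inputs above (all EXISTING named facts of the tree, taken as hypotheses; nothing minted);
* `bsz_h5_five_of_mainConjectures_of_smul_eq` — the binder `h5` on all of `S₀(5)` with (ram) read on
  a given global minimal model (`ℓ ∈ {2, 3}` allowed), below the same inputs and Greenberg–Stevens
  at `5` for every `E/ℚ`;
* `bsz_h5_five_of_mainConjectures` — the binder `h5` on all of `S₀(5)` ENTIRELY in the `(A, B)`
  currency, (ram) in the form of Remark 7 (`ℓ > 5` multiplicative, `5 ∤ ord_ℓ(4A³ + 27B²)`);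
* `bsz_thm5_of_thmC` (+ `_of_smul_eq`), `bsz_h5_five_of_thmC` (+ `_of_smul_eq`) — the «literal»
  route: Thm 5 AS PRINTED (both legs, every odd `p ≥ 3`, under (b) + (c)) and the binder `h5` on
  all of `S₀(5)`, below the ONE cited-only named fact
  `Skinner2016.thmC_one_le_selmerCorank_of_L_one_eq_zero` (Skinner 2016 Thm. C, clause (2), AS
  PRINTED; cell registry A324) — the instantiation `hC2 := A324` of the sibling's
  `bsz_thm5_of_thmC2` / `bsz_h5_five_of_thmC2` (which keep that clause as an anonymous hypothesis);
  and `BhargavaSkinnerZhang2014.thm5_rank_zero_of_pSelmer_trivial_of_thmC` — the tree's cited-only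
  fact A323 (Thm 5 AS PRINTED, `BhargavaSkinnerZhang2014/RankZeroCriterion.lean`) DERIVED from A324.

BSD-DENSITY SPRINT (cell `b2b-bsdres`, book `cells/density/CONVERSION-QUEUE.md` §2 Q1): by-name
consumer = the D2 glue `bsz_rankLeOne_cRank_of_facts` (seat `b2b-bsdres-dens-p1`), which now only
has to choose `W` (pub-bsdpct's set names, C0) and specialise one of the three `h5` theorems here;
written as D2-interim by the X3♯(M)/X4(M) row (`b2b-bsdres-additive-p1`). HONEST FRAMING: kernel
glue below NAMED published inputs; nothing is booked; no density number, RESIDUAL-MAP mark, tier or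
status word moves by this file; this is not "finishing BSD".

## References

* [BhargavaSkinnerZhang2014] M. Bhargava, C. Skinner, W. Zhang, arXiv:1407.1826v2, Thm. 5, Rem. 7,
  Rem. 8 (§2.1, p. 5); Lemma 17 (p. 8).
* [Skinner2016PacificMC] C. Skinner, Pacific J. Math. 283 (2016), 171–200: Thm. A (§1), §3.3,
  Thm. C (p. 173) clause (2).
* [BurungaleCastellaSkinner2025] A. Burungale, F. Castella, C. Skinner, IMRN 2025 =
  arXiv:2405.00270, Thm. 1.1.2 (a).
* [GreenbergLNM1716] R. Greenberg, LNM 1716 (1999), §1 pp. 65–66, Thm. 4.1, §4 pp. 112–113.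
* [SilvermanAEC2009] J. H. Silverman, GTM 106 (2009), Thm. X.4.2; X.§4; VIII.8 Cor. 8.3.
-/

/-! ### Theorem 5 on both legs of (a), `p ≥ 5`, below the main conjectures -/

section MainConjectures

/-- **Bhargava–Skinner–Zhang Thm 5, BOTH LEGS of (a), at `p ≥ 5`, below the main conjectures.**
Let `E/ℚ` have globally minimal model `W` and let `p ≥ 5` be a prime at which `W` has good
ORDINARY reduction (`p ∤ a_p`) OR multiplicative reduction (printed (a)); suppose `E[p]` is
irreducible (printed (b)), some prime `ℓ ≠ p` of multiplicative reduction has `p ∤ v_ℓ(Δ_min)`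
(printed (c), Tate form — used on the multiplicative leg only) and `#Sel^(p)(E/ℚ) = 1` (printed
(d)). Then `rank E(ℚ) = 0` and `ord_{s=1} L(E,s) = 0` — granted, on the good-ordinary leg,
modularity `hmod`, Mazur's main conjecture in the Burungale–Castella–Skinner form `hMC` and
Perrin-Riou–Schneider `hS` (sibling `bsz_thm5_goodOrdinary_of_mainConjecture`), and, on the
multiplicative leg, `hmod'`, Skinner 2016 Thm. A `hA`, Greenberg's §4 formulas `hGs` / `hGn` and
Greenberg–Stevens at `(E, p)` `hGS` (sibling `bsz_thm5_multiplicative_of_thmA`). Remark 8 of the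
source: "a consequence of … [SU] and [Smult] … both … consequences of the Iwasawa–Greenberg main
conjecture". [cite: BhargavaSkinnerZhang2014, Thm. 5 and Rem. 8 (§2.1, p. 5)]
[cite: BurungaleCastellaSkinner2025, Thm. 1.1.2 (a)] [cite: Skinner2016PacificMC, Thm. A (§1) and §3.3] -/
theorem bsz_thm5_of_mainConjectures
    (hmod : exists_isNewformOf)
    (hMC : burungale_castella_skinner_charIdeal_eq_padicLFunction)
    (hS : Schneider1985_order_charGenerator)
    (hmod' : nonempty_modularParametrizationData)
    (hA : Skinner2016.thmA_charIdeal_multiplicative)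
    (hGs : Greenberg1999.thm41Analogue_charValue_rankZero_split_baseChange_anyPrime)
    (hGn : Greenberg1999.thm41Analogue_charValue_rankZero_numberField_anyPrime)
    (W : WeierstrassCurve ℚ) [W.IsElliptic] [W.IsGloballyMinimal] (p : ℕ) [Fact p.Prime]
    (hGS : greenberg_stevens (W := W) (p := p)) (hp : 5 ≤ p)
    (hred : (W.HasGoodReductionAtPrime p ∧ ¬ (p : ℤ) ∣ W.frobeniusTrace p) ∨
      W.HasMultiplicativeReductionAtPrime p)
    (hirr : W.HasIrreducibleModPGaloisRep p)
    (hram : ∃ ℓ : ℕ, ∃ _ : Fact ℓ.Prime, ℓ ≠ p ∧ W.HasMultiplicativeReductionAtPrime ℓ ∧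
      ¬ p ∣ padicValInt ℓ W.minimalDiscriminantInt)
    (hSel : Nat.card (W.selmerGroup p) = 1) :
    W.mordellWeilRank = 0 ∧ W.analyticRank = 0 := by
  rcases hred with ⟨hgood, hord⟩ | hmult
  · exact bsz_thm5_goodOrdinary_of_mainConjecture hmod hMC hS W p hp hgood hord hirr hSel
  · exact bsz_thm5_multiplicative_of_thmA hmod' hA hGs hGn W p hGS (by omega) hmult hirr hram hSel

/-- **Thm 5, both legs of (a), `p ≥ 5`, below the main conjectures, for an ARBITRARY model** `E`
with global minimal model `W`, `C • W = E`: (a) and (c) are read on `W` (they mention `a_p` and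
`Δ_min`), (b) and (d) on `E` (isomorphism invariants); conclusion for `E` (siblings
`bsz_thm5_goodOrdinary_of_mainConjecture_of_smul_eq`, `bsz_thm5_multiplicative_of_thmA_of_smul_eq`).
[cite: BhargavaSkinnerZhang2014, Thm. 5 (§2.1, p. 5)] [cite: SilvermanAEC2009, X.§4 and VIII.8 Cor. 8.3] -/
theorem bsz_thm5_of_mainConjectures_of_smul_eq
    (hmod : exists_isNewformOf)
    (hMC : burungale_castella_skinner_charIdeal_eq_padicLFunction)
    (hS : Schneider1985_order_charGenerator)
    (hmod' : nonempty_modularParametrizationData)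
    (hA : Skinner2016.thmA_charIdeal_multiplicative)
    (hGs : Greenberg1999.thm41Analogue_charValue_rankZero_split_baseChange_anyPrime)
    (hGn : Greenberg1999.thm41Analogue_charValue_rankZero_numberField_anyPrime)
    {W : WeierstrassCurve ℚ} [W.IsElliptic] [W.IsGloballyMinimal] {C : VariableChange ℚ}
    {E : WeierstrassCurve ℚ} [E.IsElliptic] (hCW : C • W = E) (p : ℕ) [Fact p.Prime]
    (hGS : greenberg_stevens (W := W) (p := p)) (hp : 5 ≤ p)
    (hred : (W.HasGoodReductionAtPrime p ∧ ¬ (p : ℤ) ∣ W.frobeniusTrace p) ∨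
      W.HasMultiplicativeReductionAtPrime p)
    (hirr : E.HasIrreducibleModPGaloisRep p)
    (hram : ∃ ℓ : ℕ, ∃ _ : Fact ℓ.Prime, ℓ ≠ p ∧ W.HasMultiplicativeReductionAtPrime ℓ ∧
      ¬ p ∣ padicValInt ℓ W.minimalDiscriminantInt)
    (hSel : Nat.card (E.selmerGroup p) = 1) :
    E.mordellWeilRank = 0 ∧ E.analyticRank = 0 := by
  rcases hred with ⟨hgood, hord⟩ | hmult
  · exact bsz_thm5_goodOrdinary_of_mainConjecture_of_smul_eq hmod hMC hS hCW p hp hgood hord hirr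
      hSel
  · exact bsz_thm5_multiplicative_of_thmA_of_smul_eq hmod' hA hGs hGn hCW p hGS (by omega) hmult hirr
      hram hSel

/-- **The binder `h5` of `bsz_rankLeOne_cRank_of_pieces` on ALL of `S₀(5) = {5 ∤ A}`, below the
main conjectures, (ram) read on a given global minimal model.** For `(A, B)` in the height family
and a global minimal model `W` of `E_{A,B}` (`C • W = E_{A,B}`): if `5 ∤ A` — i.e. `E_{A,B} ∈ S₀(5)`,
good ordinary or multiplicative at `5` (Lemma 17 of the source, tree `bsz_lemma17_mem_S0_five_iff`)
—, `E_{A,B}[5]` is irreducible (printed (b)), some prime `ℓ ≠ 5` of multiplicative reduction of `W`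
has `5 ∤ v_ℓ(Δ_min)` (printed (c), Tate form; `ℓ ∈ {2, 3}` allowed) and `#Sel^(5)(E_{A,B}/ℚ) = 1`
(printed (d)), then `rank E_{A,B}(ℚ) = 0 ∧ ord_{s=1} L(E_{A,B}, s) = 0` — granted the seven named
inputs and Greenberg–Stevens at `5` for every `E/ℚ` (`hGS`).
[cite: BhargavaSkinnerZhang2014, Thm. 5 (§2.1, p. 5) and Lemma 17 (p. 8)] -/
theorem bsz_h5_five_of_mainConjectures_of_smul_eq
    (hmod : exists_isNewformOf)
    (hMC : burungale_castella_skinner_charIdeal_eq_padicLFunction)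
    (hS : Schneider1985_order_charGenerator)
    (hmod' : nonempty_modularParametrizationData)
    (hA : Skinner2016.thmA_charIdeal_multiplicative)
    (hGs : Greenberg1999.thm41Analogue_charValue_rankZero_split_baseChange_anyPrime)
    (hGn : Greenberg1999.thm41Analogue_charValue_rankZero_numberField_anyPrime)
    [Fact (Nat.Prime 5)]
    (hGS : ∀ (V : WeierstrassCurve ℚ) [V.IsElliptic] [V.IsGloballyMinimal],
      greenberg_stevens (W := V) (p := 5))
    {W : WeierstrassCurve ℚ} [W.IsElliptic] [W.IsGloballyMinimal] {C : VariableChange ℚ}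
    {AB : ℤ × ℤ} (hfam : IsInHeightFamily AB) (hCW : C • W = shortWeierstrass AB)
    (hA5 : ¬ (5 : ℤ) ∣ AB.1) (hirr : (shortWeierstrass AB).HasIrreducibleModPGaloisRep 5)
    (hram : ∃ ℓ : ℕ, ∃ _ : Fact ℓ.Prime, ℓ ≠ 5 ∧ W.HasMultiplicativeReductionAtPrime ℓ ∧
      ¬ 5 ∣ padicValInt ℓ W.minimalDiscriminantInt)
    (hSel : Nat.card ((shortWeierstrass AB).selmerGroup 5) = 1) :
    (shortWeierstrass AB).mordellWeilRank = 0 ∧ (shortWeierstrass AB).analyticRank = 0 := by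
  haveI := isElliptic_shortWeierstrass hfam
  have hred := (bsz_lemma17_mem_S0_five_iff hfam hCW).2 hA5
  exact bsz_thm5_of_mainConjectures_of_smul_eq hmod hMC hS hmod' hA hGs hGn hCW 5 (hGS W) le_rfl
    (by exact_mod_cast hred) hirr (by exact_mod_cast hram) (by exact_mod_cast hSel)

/-- **The binder `h5` of `bsz_rankLeOne_cRank_of_pieces` on ALL of `S₀(5) = {5 ∤ A}`, ENTIRELY IN
THE `(A, B)` CURRENCY of the height family, below the main conjectures.** Hypotheses on `(A, B) ∈`
the family: `5 ∤ A` (= `S₀(5)`, Lemma 17); `E_{A,B}[5]` irreducible (printed (b)); printed (c) in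
the form of Remark 7 of the source ("for `ℓ ≥ 5`, a Weierstrass equation `E_{A,B}` … is minimal at
`ℓ`, and so if `ℓ ‖ N` then `E_{A,B}[p]` is ramified at `ℓ` if and only if `p ∤ ord_ℓ(Δ(E_{A,B}))`"):
some prime `ℓ > 5` of multiplicative reduction of `E_{A,B}` with `5 ∤ ord_ℓ(4A³ + 27B²)`; and
`#Sel^(5)(E_{A,B}/ℚ) = 1` (printed (d)). Conclusion: `rank E_{A,B}(ℚ) = 0 ∧ ord_{s=1} L(E_{A,B}, s) = 0`,
granted the seven named inputs and Greenberg–Stevens at `5` for every `E/ℚ`. Case split on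
`5 ∣ 4A³ + 27B²` (multiplicative at `5`: sibling `bsz_h5_multiplicative_five_of_thmA`) versus
`5 ∤ 4A³ + 27B²` (good ordinary at `5`: sibling `bsz_h5_goodOrdinary_five_of_mainConjecture`, where
(c) is not used). [cite: BhargavaSkinnerZhang2014, Thm. 5, Rem. 7 (§2.1, p. 5) and Lemma 17 (p. 8)] -/
theorem bsz_h5_five_of_mainConjectures
    (hmod : exists_isNewformOf)
    (hMC : burungale_castella_skinner_charIdeal_eq_padicLFunction)
    (hS : Schneider1985_order_charGenerator)
    (hmod' : nonempty_modularParametrizationData)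
    (hA : Skinner2016.thmA_charIdeal_multiplicative)
    (hGs : Greenberg1999.thm41Analogue_charValue_rankZero_split_baseChange_anyPrime)
    (hGn : Greenberg1999.thm41Analogue_charValue_rankZero_numberField_anyPrime)
    [Fact (Nat.Prime 5)]
    (hGS : ∀ (V : WeierstrassCurve ℚ) [V.IsElliptic] [V.IsGloballyMinimal],
      greenberg_stevens (W := V) (p := 5))
    {AB : ℤ × ℤ} (hfam : IsInHeightFamily AB) (hA5 : ¬ (5 : ℤ) ∣ AB.1)
    (hirr : (shortWeierstrass AB).HasIrreducibleModPGaloisRep 5)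
    (hram : ∃ ℓ : ℕ, ∃ _ : Fact ℓ.Prime, 5 < ℓ ∧
      (shortWeierstrass AB).HasMultiplicativeReductionAtPrime ℓ ∧
      ¬ 5 ∣ padicValInt ℓ (4 * AB.1 ^ 3 + 27 * AB.2 ^ 2))
    (hSel : Nat.card ((shortWeierstrass AB).selmerGroup 5) = 1) :
    (shortWeierstrass AB).mordellWeilRank = 0 ∧ (shortWeierstrass AB).analyticRank = 0 := by
  by_cases hD : (5 : ℤ) ∣ 4 * AB.1 ^ 3 + 27 * AB.2 ^ 2
  · exact bsz_h5_multiplicative_five_of_thmA hmod' hA hGs hGn hGS hfam hA5 hD hirr hram hSel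
  · exact bsz_h5_goodOrdinary_five_of_mainConjecture hmod hMC hS hfam hA5 hD hirr hSel

end MainConjectures

/-! ### The «literal» route: Theorem 5 as printed and `h5` on all of `S₀(5)` below A324 -/

section ThmC

/-- **Bhargava–Skinner–Zhang Thm 5 AS PRINTED (both legs of (a), every prime `p ≥ 3`, under
(b) = (irr) and (c) = (ram)), below ONE cited-only named fact:** Skinner, Pacific J. Math. 283
(2016), Thm. C, clause (2) ("if `L(E,1) = 0` then `Sel_{p^∞}(E)` has `ℤ_p`-corank at least one"),
tree `Skinner2016.thmC_one_le_selmerCorank_of_L_one_eq_zero` (cell registry A324). `E/ℚ` with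
globally minimal model `W`; the instantiation `hC2 := A324` of the sibling's `bsz_thm5_of_thmC2`.
[cite: BhargavaSkinnerZhang2014, Thm. 5 and Rem. 8 (§2.1, p. 5)]
[cite: Skinner2016PacificMC, Thm. C (§1, p. 173), clause (2)] -/
theorem bsz_thm5_of_thmC
    (hC : Skinner2016.thmC_one_le_selmerCorank_of_L_one_eq_zero)
    (W : WeierstrassCurve ℚ) [W.IsElliptic] [W.IsGloballyMinimal] (p : ℕ) [Fact p.Prime]
    (hp : 3 ≤ p)
    (hred : (W.HasGoodReductionAtPrime p ∧ ¬ (p : ℤ) ∣ W.frobeniusTrace p) ∨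
      W.HasMultiplicativeReductionAtPrime p)
    (hirr : W.HasIrreducibleModPGaloisRep p)
    (hram : ∃ ℓ : ℕ, ∃ _ : Fact ℓ.Prime, ℓ ≠ p ∧ W.HasMultiplicativeReductionAtPrime ℓ ∧
      ¬ p ∣ padicValInt ℓ W.minimalDiscriminantInt)
    (hSel : Nat.card (W.selmerGroup p) = 1) :
    W.mordellWeilRank = 0 ∧ W.analyticRank = 0 :=
  bsz_thm5_of_thmC2 hC W p hp hred hirr hram hSel

/-- **Thm 5 as printed, below A324, for an ARBITRARY model** `E` with global minimal model `W`,
`C • W = E` ((a), (c) read on `W`; (b), (d) on `E`); the instantiation `hC2 := A324` of the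
sibling's `bsz_thm5_of_thmC2_of_smul_eq`. [cite: BhargavaSkinnerZhang2014, Thm. 5 (§2.1, p. 5)]
[cite: Skinner2016PacificMC, Thm. C (§1, p. 173), clause (2)] -/
theorem bsz_thm5_of_thmC_of_smul_eq
    (hC : Skinner2016.thmC_one_le_selmerCorank_of_L_one_eq_zero)
    {W : WeierstrassCurve ℚ} [W.IsElliptic] [W.IsGloballyMinimal] {C : VariableChange ℚ}
    {E : WeierstrassCurve ℚ} [E.IsElliptic] (hCW : C • W = E) (p : ℕ) [Fact p.Prime]
    (hp : 3 ≤ p)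
    (hred : (W.HasGoodReductionAtPrime p ∧ ¬ (p : ℤ) ∣ W.frobeniusTrace p) ∨
      W.HasMultiplicativeReductionAtPrime p)
    (hirr : E.HasIrreducibleModPGaloisRep p)
    (hram : ∃ ℓ : ℕ, ∃ _ : Fact ℓ.Prime, ℓ ≠ p ∧ W.HasMultiplicativeReductionAtPrime ℓ ∧
      ¬ p ∣ padicValInt ℓ W.minimalDiscriminantInt)
    (hSel : Nat.card (E.selmerGroup p) = 1) :
    E.mordellWeilRank = 0 ∧ E.analyticRank = 0 :=
  bsz_thm5_of_thmC2_of_smul_eq hC hCW p hp hred hirr hram hSel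

/-- **The binder `h5` of `bsz_rankLeOne_cRank_of_pieces` on ALL of `S₀(5) = {5 ∤ A}` below A324**,
(ram) read on a given global minimal model `W` of `E_{A,B}` (`C • W = E_{A,B}`; `ℓ ∈ {2, 3}`
allowed): `5 ∤ A`, `E_{A,B}[5]` irreducible, (ram) at `5` on `W`, `#Sel^(5)(E_{A,B}/ℚ) = 1` ⟹
`rank E_{A,B}(ℚ) = 0 ∧ ord_{s=1} L(E_{A,B}, s) = 0`; the instantiation `hC2 := A324` of the
sibling's `bsz_h5_five_of_thmC2_of_smul_eq`.
[cite: BhargavaSkinnerZhang2014, Thm. 5 (§2.1, p. 5) and Lemma 17 (p. 8)]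
[cite: Skinner2016PacificMC, Thm. C (§1, p. 173), clause (2)] -/
theorem bsz_h5_five_of_thmC_of_smul_eq
    (hC : Skinner2016.thmC_one_le_selmerCorank_of_L_one_eq_zero)
    {W : WeierstrassCurve ℚ} [W.IsElliptic] [W.IsGloballyMinimal] {C : VariableChange ℚ}
    {AB : ℤ × ℤ} (hfam : IsInHeightFamily AB) (hCW : C • W = shortWeierstrass AB)
    (hA5 : ¬ (5 : ℤ) ∣ AB.1) (hirr : (shortWeierstrass AB).HasIrreducibleModPGaloisRep 5)
    (hram : ∃ ℓ : ℕ, ∃ _ : Fact ℓ.Prime, ℓ ≠ 5 ∧ W.HasMultiplicativeReductionAtPrime ℓ ∧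
      ¬ 5 ∣ padicValInt ℓ W.minimalDiscriminantInt)
    (hSel : Nat.card ((shortWeierstrass AB).selmerGroup 5) = 1) :
    (shortWeierstrass AB).mordellWeilRank = 0 ∧ (shortWeierstrass AB).analyticRank = 0 :=
  bsz_h5_five_of_thmC2_of_smul_eq hC hfam hCW hA5 hirr hram hSel

/-- **The binder `h5` of `bsz_rankLeOne_cRank_of_pieces` on ALL of `S₀(5) = {5 ∤ A}` below A324,
ENTIRELY IN THE `(A, B)` CURRENCY** ((ram) in the form of Remark 7: some prime `ℓ > 5` of
multiplicative reduction of `E_{A,B}` with `5 ∤ ord_ℓ(4A³ + 27B²)`); the instantiation `hC2 := A324`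
of the sibling's `bsz_h5_five_of_thmC2`.
[cite: BhargavaSkinnerZhang2014, Thm. 5, Rem. 7 (§2.1, p. 5) and Lemma 17 (p. 8)]
[cite: Skinner2016PacificMC, Thm. C (§1, p. 173), clause (2)] -/
theorem bsz_h5_five_of_thmC
    (hC : Skinner2016.thmC_one_le_selmerCorank_of_L_one_eq_zero)
    {AB : ℤ × ℤ} (hfam : IsInHeightFamily AB) (hA5 : ¬ (5 : ℤ) ∣ AB.1)
    (hirr : (shortWeierstrass AB).HasIrreducibleModPGaloisRep 5)
    (hram : ∃ ℓ : ℕ, ∃ _ : Fact ℓ.Prime, 5 < ℓ ∧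
      (shortWeierstrass AB).HasMultiplicativeReductionAtPrime ℓ ∧
      ¬ 5 ∣ padicValInt ℓ (4 * AB.1 ^ 3 + 27 * AB.2 ^ 2))
    (hSel : Nat.card ((shortWeierstrass AB).selmerGroup 5) = 1) :
    (shortWeierstrass AB).mordellWeilRank = 0 ∧ (shortWeierstrass AB).analyticRank = 0 :=
  bsz_h5_five_of_thmC2 hC hfam hA5 hirr hram hSel

/-- **A323 below A324: Bhargava–Skinner–Zhang Thm 5 AS PRINTED — the tree's cited-only named fact
`BhargavaSkinnerZhang2014.thm5_rank_zero_of_pSelmer_trivial` (every odd prime `p ≥ 3`, (a) good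
ordinary or multiplicative, (b) = (irr), (c) = (ram), (d) `#Sel^(p)(E/ℚ) = 1` ⟹ rank `0` and
analytic rank `0`; cell registry A323, «literal-sec») — FOLLOWS from Skinner 2016 Thm. C clause (2)
AS PRINTED (`Skinner2016.thmC_one_le_selmerCorank_of_L_one_eq_zero`, A324) and exact descent**
(sibling `bsz_thm5_of_thmC2`: `#Sel^(p) = 1` gives rank `0` and corank `0` fact-free, clause (2)
then forbids `L(E,1) = 0`). This is the deduction the source prints (Thm 5 "is deduced from results
in [SU] and [Smult]", Rem. 8), with [SU]'s good-ordinary leg read through [Smult] Thm. C, whose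
hypothesis (a) already allows good ordinary reduction. A by-name consumer of A323 may therefore take
A324 instead. [cite: BhargavaSkinnerZhang2014, Thm. 5 and Rem. 8 (§2.1, p. 5)]
[cite: Skinner2016PacificMC, Thm. C (§1, p. 173), clause (2)] -/
theorem BhargavaSkinnerZhang2014.thm5_rank_zero_of_pSelmer_trivial_of_thmC
    (hC : Skinner2016.thmC_one_le_selmerCorank_of_L_one_eq_zero) :
    BhargavaSkinnerZhang2014.thm5_rank_zero_of_pSelmer_trivial :=
  fun W _ _ p _ hp hred hirr hram hSel ↦ bsz_thm5_of_thmC2 hC W p hp hred hirr hram hSel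

end ThmC

end Literature.NumberTheory.EllipticCurves

end
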